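/-
Copyright (c) 2026. All rights reserved.
Released under Apache 2.0 license as described in the file LICENSE.
Authors: HodgeCM publication cell (pub-hodgecm), DAG-node prover lineage #14 (gen 6: statements and proofs;
gen 7: tree port).
-/
import Literature.Analysis.Distribution.SchwartzExpFlow
import Mathlib.Analysis.Calculus.MeanValue
import Mathlib.Analysis.SpecialFunctions.Trigonometric.Deriv
import HarnessLib

/-!
# Closed forms of `exp(sA)`: `cosh s · 1 + sinh s · J` (`J² = 1`), `cos s · 1 + sin s · A` (`A² = -1`); transport

Topic `Analysis/Distribution`; namespace `Literature.Analysis.Distribution`.  Three bookkeeping complements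
to `SchwartzHyperbolicFlow` (closed form `involFlow J hJ s = cosh s · 1 + sinh s · J`) and `SchwartzExpFlow`
(Mathlib's operator exponential `expFlow A s = exp(sA)`):

* **Transport.**  Consumers build their flows differently (e.g. by transporting a coordinate formula along
  `EuclideanSpace.equiv`) and then prove an identity `↑(g s) = cosh s • 1 + sinh s • J`.
  `eq_involFlow_of_coe_eq` / `eq_involFlow_of_apply_eq`: such a `g : ℝ → (E ≃L[ℝ] E)` IS `involFlow J hJ`
  (continuous linear equivalences are determined by their underlying maps); hence, for such `g`, at every
  base point and for real or complex scalars: `tendsto_compCLM_sub_div_at_of_coe_eq`,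
  `hasDerivAt_apply_compCLM_of_coe_eq`, `contDiff_apply_compCLM_of_coe_eq`,
  `iteratedDeriv_apply_compCLM_of_coe_eq`, `tendsto_compCLM_sub_div_ofReal_at_of_coe_eq`, and
  `tendsto_compCLM_sub_div_ofReal_of_coe_eq : ((s : ℂ))⁻¹ • (Φ ∘ g s - Φ) → flowGen J Φ` (`s → 0`, `s ≠ 0`).
* **Hyperbolic closed form.**  `hasDerivAt_coshSinhCLM`:
  `d/ds (cosh s · 1 + sinh s · J) = J (cosh s · 1 + sinh s · J)`;
  `expCLM_eq_coshSinhCLM : exp(sJ) = cosh s · 1 + sinh s · J` — by the derivative argument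
  `d/ds [exp(sJ) (cosh s · 1 - sinh s · J)] = 0` and Mathlib's `is_const_of_deriv_eq_zero` (no power series
  are rearranged); **`expFlow_eq_involFlow : expFlow J = involFlow J hJ`**, so every statement of
  `SchwartzHyperbolicFlow(Coord)` about `involFlow` is a statement about `exp(sJ)` and conversely.
* **Elliptic closed form.**  For a complex structure `A` (`A² = -1`): `cosSinCLM A s = cos s · 1 + sin s · A`,
  its group law, `expCLM_eq_cosSinCLM : exp(sA) = cos s · 1 + sin s · A` by the same derivative argument,
  `expFlow_apply_eq_cos_add_sin`, and periodicity `expFlow_add_two_pi` — the `exp(sA)` smooth-vector theorems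
  of `SchwartzExpFlow` thus cover the compact one-parameter subgroups `SO(2) ⊂ GL(E)` in closed form.

(Standard facts about matrix / operator exponentials; e.g. B. C. Hall's treatment of one-parameter
subgroups, or M. Reed, B. Simon, *Methods of Modern Mathematical Physics I* [ReedSimonI1980], Ch. VIII for
the functional calculus background.)  Design: the closed forms are proved through the ODE they satisfy, so
only `HasDerivAt` calculus and `NormedSpace.exp`'s derivative (`hasDerivAt_exp_smul_const'`) are used.  NOT
here: spectral decompositions, nilpotent generators.

Provenance: tree port (LEAN-IN-TREE, 2026-08-18) of the HodgeCM publication cell's package files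
`HodgeCM/Automorphic/SchwartzInvolFlowTransport.lean`, `…/SchwartzExpFlowInvol.lean` and
`…/SchwartzExpFlowRotation.lean` (unit `pub-hodgecm-pv14-g6`, gate run 31; namespace `HodgeCM.SchwartzWeil`
↦ `Literature.Analysis.Distribution`, statements verbatim).  Nothing in this file is specific to that cell
or under adjudication there.
-/

set_option autoImplicit false

noncomputable section

open Filter Topology
open scoped SchwartzMap ContDiff

namespace Literature.Analysis.Distribution

/-! ## Transport of the involutive-flow calculus to any family with the same matrix -/

section Uniqueness

variable {E : Type*} [NormedAddCommGroup E] [NormedSpace ℝ E] {J : E →L[ℝ] E} (hJ : J * J = 1)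
  {g : ℝ → (E ≃L[ℝ] E)}

/-- A family of continuous linear automorphisms whose matrices are `cosh s · 1 + sinh s · J` is the
flow `involFlow J hJ`. [folklore] -/
theorem eq_involFlow_of_coe_eq
    (hg : ∀ s, ((g s : E ≃L[ℝ] E) : E →L[ℝ] E) = Real.cosh s • (1 : E →L[ℝ] E) + Real.sinh s • J) :
    g = involFlow J hJ := by
  funext s
  refine ContinuousLinearEquiv.ext ?_
  have h : ((g s : E ≃L[ℝ] E) : E →L[ℝ] E) = ((involFlow J hJ s : E ≃L[ℝ] E) : E →L[ℝ] E) := by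
    rw [hg s, coe_involFlow]; rfl
  exact congrArg (fun T : E →L[ℝ] E => (T : E → E)) h

/-- The same from the pointwise formula `g s x = cosh s • x + sinh s • J x`. [folklore] -/
theorem eq_involFlow_of_apply_eq (hg : ∀ s x, g s x = Real.cosh s • x + Real.sinh s • J x) :
    g = involFlow J hJ := by
  funext s
  refine ContinuousLinearEquiv.ext (funext fun x => ?_)
  rw [hg s x]
  exact (involFlow_apply J hJ s x).symm

end Uniqueness

section Schwartz

variable {E F G : Type*} [NormedAddCommGroup E] [NormedSpace ℝ E] [NormedAddCommGroup F]
  [NormedSpace ℝ F] [NormedAddCommGroup G] [NormedSpace ℝ G]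
variable (𝕜 : Type*) [RCLike 𝕜] [NormedSpace 𝕜 F] [SMulCommClass ℝ 𝕜 F]
variable {J : E →L[ℝ] E} (hJ : J * J = 1) {g : ℝ → (E ≃L[ℝ] E)}
  (hg : ∀ s, ((g s : E ≃L[ℝ] E) : E →L[ℝ] E) = Real.cosh s • (1 : E →L[ℝ] E) + Real.sinh s • J)
include hJ hg

/-- **Differentiability of `Φ ↦ Φ ∘ g s` in the Schwartz topology at every base point**, for any family
`g` with matrices `cosh s · 1 + sinh s · J`. [folklore] -/
theorem tendsto_compCLM_sub_div_at_of_coe_eq (Φ : 𝓢(E, F)) (s₀ : ℝ) :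
    Tendsto (fun s : ℝ => s⁻¹ • (SchwartzMap.compCLMOfContinuousLinearEquiv 𝕜 (g (s₀ + s)) Φ
        - SchwartzMap.compCLMOfContinuousLinearEquiv 𝕜 (g s₀) Φ)) (𝓝[≠] 0)
      (𝓝 (flowGen J (SchwartzMap.compCLMOfContinuousLinearEquiv 𝕜 (g s₀) Φ))) := by
  rw [eq_involFlow_of_coe_eq hJ hg]
  exact tendsto_compCLM_involFlow_sub_div_at 𝕜 J hJ Φ s₀

/-- Scalar coefficients `s ↦ T (Φ ∘ g s)` are differentiable with derivative `T (flowGen J (Φ ∘ g s₀))`. [folklore] -/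
theorem hasDerivAt_apply_compCLM_of_coe_eq (T : 𝓢(E, F) →L[ℝ] G) (Φ : 𝓢(E, F)) (s₀ : ℝ) :
    HasDerivAt (fun s => T (SchwartzMap.compCLMOfContinuousLinearEquiv 𝕜 (g s) Φ))
      (T (flowGen J (SchwartzMap.compCLMOfContinuousLinearEquiv 𝕜 (g s₀) Φ))) s₀ := by
  rw [eq_involFlow_of_coe_eq hJ hg]
  exact hasDerivAt_apply_compCLM_involFlow 𝕜 J hJ T Φ s₀

/-- Scalar coefficients `s ↦ T (Φ ∘ g s)` are `C^∞`. [folklore] -/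
theorem contDiff_apply_compCLM_of_coe_eq (T : 𝓢(E, F) →L[ℝ] G) (Φ : 𝓢(E, F)) :
    ContDiff ℝ ∞ (fun s : ℝ => T (SchwartzMap.compCLMOfContinuousLinearEquiv 𝕜 (g s) Φ)) := by
  rw [eq_involFlow_of_coe_eq hJ hg]
  exact contDiff_apply_compCLM_involFlow 𝕜 J hJ T Φ

/-- Their iterated derivatives. [folklore] -/
theorem iteratedDeriv_apply_compCLM_of_coe_eq (T : 𝓢(E, F) →L[ℝ] G) (Φ : 𝓢(E, F)) (k : ℕ) :
    iteratedDeriv k (fun s : ℝ => T (SchwartzMap.compCLMOfContinuousLinearEquiv 𝕜 (g s) Φ))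
      = fun s => T ((flowGen J)^[k] (SchwartzMap.compCLMOfContinuousLinearEquiv 𝕜 (g s) Φ)) := by
  rw [eq_involFlow_of_coe_eq hJ hg]
  exact iteratedDeriv_apply_compCLM_involFlow 𝕜 J hJ T Φ k

end Schwartz

section Complex

variable {E F : Type*} [NormedAddCommGroup E] [NormedSpace ℝ E] [NormedAddCommGroup F]
  [NormedSpace ℝ F] [NormedSpace ℂ F] [IsScalarTower ℝ ℂ F] [SMulCommClass ℝ ℂ F]
variable {J : E →L[ℝ] E} (hJ : J * J = 1) {g : ℝ → (E ≃L[ℝ] E)}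
  (hg : ∀ s, ((g s : E ≃L[ℝ] E) : E →L[ℝ] E) = Real.cosh s • (1 : E →L[ℝ] E) + Real.sinh s • J)
include hJ hg

/-- **Complex scalars, every base point.** [folklore] -/
theorem tendsto_compCLM_sub_div_ofReal_at_of_coe_eq (Φ : 𝓢(E, F)) (s₀ : ℝ) :
    Tendsto (fun s : ℝ => ((s : ℂ))⁻¹
        • (SchwartzMap.compCLMOfContinuousLinearEquiv ℂ (g (s₀ + s)) Φ
          - SchwartzMap.compCLMOfContinuousLinearEquiv ℂ (g s₀) Φ)) (𝓝[≠] 0)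
      (𝓝 (flowGen J (SchwartzMap.compCLMOfContinuousLinearEquiv ℂ (g s₀) Φ))) := by
  rw [eq_involFlow_of_coe_eq hJ hg]
  exact tendsto_compCLM_involFlow_sub_div_ofReal_at J hJ Φ s₀

/-- **Complex scalars at `0` — the literal shape of a smooth-vector clause**:
`((s : ℂ))⁻¹ • (Φ ∘ g s - Φ) → flowGen J Φ` for any family `g` with matrices `cosh s · 1 + sinh s · J`. [folklore] -/
theorem tendsto_compCLM_sub_div_ofReal_of_coe_eq (Φ : 𝓢(E, F)) :
    Tendsto (fun s : ℝ => ((s : ℂ))⁻¹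
        • (SchwartzMap.compCLMOfContinuousLinearEquiv ℂ (g s) Φ - Φ)) (𝓝[≠] 0)
      (𝓝 (flowGen J Φ)) := by
  rw [eq_involFlow_of_coe_eq hJ hg]
  exact tendsto_compCLM_involFlow_sub_div_ofReal J hJ Φ

end Complex


/-! ## `exp(sJ) = cosh s · 1 + sinh s · J` for `J² = 1` -/

section ExpInvol

variable {E : Type*} [NormedAddCommGroup E] [NormedSpace ℝ E] (J : E →L[ℝ] E) (hJ : J * J = 1)
include hJ

/-- `d/ds (cosh s · 1 + sinh s · J) = J · (cosh s · 1 + sinh s · J)` when `J² = 1`. [folklore] -/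
theorem hasDerivAt_coshSinhCLM (s₀ : ℝ) :
    HasDerivAt (coshSinhCLM J) (J * coshSinhCLM J s₀) s₀ := by
  have h := ((Real.hasDerivAt_cosh s₀).smul_const (1 : E →L[ℝ] E)).add
    ((Real.hasDerivAt_sinh s₀).smul_const J)
  have e : Real.sinh s₀ • (1 : E →L[ℝ] E) + Real.cosh s₀ • J = J * coshSinhCLM J s₀ := by
    simp only [coshSinhCLM, mul_add, mul_smul_comm, mul_one, hJ]
    abel
  rw [← e]
  exact h

/-- `d/ds (cosh s · 1 - sinh s · J) = -J · (cosh s · 1 - sinh s · J)`, i.e. the derivative of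
`s ↦ coshSinhCLM J (-s)`. [folklore] -/
theorem hasDerivAt_coshSinhCLM_neg (s₀ : ℝ) :
    HasDerivAt (fun s => coshSinhCLM J (-s)) (-(J * coshSinhCLM J (-s₀))) s₀ := by
  have h := ((Real.hasDerivAt_cosh s₀).smul_const (1 : E →L[ℝ] E)).sub
    ((Real.hasDerivAt_sinh s₀).smul_const J)
  have e : Real.sinh s₀ • (1 : E →L[ℝ] E) - Real.cosh s₀ • J = -(J * coshSinhCLM J (-s₀)) := by
    simp only [coshSinhCLM, Real.cosh_neg, Real.sinh_neg, mul_add, mul_smul_comm, mul_one, hJ, neg_smul,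
      mul_neg, neg_add, neg_neg]
    abel
  rw [← e]
  refine h.congr_of_eventuallyEq (Eventually.of_forall fun s => ?_)
  show coshSinhCLM J (-s) = Real.cosh s • (1 : E →L[ℝ] E) - Real.sinh s • J
  rw [coshSinhCLM, Real.cosh_neg, Real.sinh_neg, neg_smul, sub_eq_add_neg]

variable [CompleteSpace E]

/-- The conserved quantity: `exp(sJ) · (cosh s · 1 - sinh s · J) = 1` for all `s`. [folklore] -/
theorem expCLM_mul_coshSinhCLM_neg (s : ℝ) : expCLM J s * coshSinhCLM J (-s) = 1 := by
  have hd : ∀ t : ℝ, HasDerivAt (fun t => expCLM J t * coshSinhCLM J (-t)) 0 t := by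
    intro t
    have h1 : HasDerivAt (fun t : ℝ => expCLM J t) (J * NormedSpace.exp (t • J)) t :=
      hasDerivAt_exp_smul_const' J t
    have h := h1.mul (hasDerivAt_coshSinhCLM_neg J hJ t)
    have hc : J * NormedSpace.exp (t • J) = NormedSpace.exp (t • J) * J :=
      (((Commute.refl J).smul_right t).exp_right).eq
    have e : J * NormedSpace.exp (t • J) * coshSinhCLM J (-t)
        + expCLM J t * -(J * coshSinhCLM J (-t)) = 0 := by
      rw [hc, expCLM_def, mul_neg, mul_assoc, add_neg_cancel]
    rw [← e]
    exact h
  have hconst := is_const_of_deriv_eq_zero (fun t => (hd t).differentiableAt) (fun t => (hd t).deriv)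
  rw [hconst s 0, expCLM_zero, neg_zero, coshSinhCLM_zero, one_mul]

/-- **`exp(sJ) = cosh s · 1 + sinh s · J`** for an involutive generator. [folklore] -/
theorem expCLM_eq_coshSinhCLM (s : ℝ) : expCLM J s = coshSinhCLM J s := by
  calc expCLM J s = expCLM J s * (coshSinhCLM J (-s) * coshSinhCLM J s) := by
        rw [← coshSinhCLM_add J hJ, neg_add_cancel, coshSinhCLM_zero, mul_one]
    _ = coshSinhCLM J s := by rw [← mul_assoc, expCLM_mul_coshSinhCLM_neg J hJ, one_mul]

/-- `exp(sJ) = cosh s • 1 + sinh s • J` (`J² = 1`), Mathlib-exponential form. [folklore] -/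
theorem exp_smul_eq_coshSinhCLM (s : ℝ) :
    NormedSpace.exp (s • J) = Real.cosh s • (1 : E →L[ℝ] E) + Real.sinh s • J :=
  expCLM_eq_coshSinhCLM J hJ s

/-- **The exponential flow of an involutive generator is the involutive flow**:
`expFlow J = involFlow J hJ` as families of continuous linear equivalences. [folklore] -/
theorem expFlow_eq_involFlow : expFlow J = involFlow J hJ :=
  eq_involFlow_of_coe_eq hJ fun s => by rw [coe_expFlow, exp_smul_eq_coshSinhCLM J hJ]

/-- `expFlow J s x = cosh s • x + sinh s • J x` (`J² = 1`). [folklore] -/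
theorem expFlow_apply_eq_involFlow_apply (s : ℝ) (x : E) :
    expFlow J s x = Real.cosh s • x + Real.sinh s • J x := by
  rw [expFlow_eq_involFlow J hJ, involFlow_apply]

end ExpInvol


/-! ## `exp(sA) = cos s · 1 + sin s · A` for `A² = -1`: rotations -/

section ExpRotation

variable {E : Type*} [NormedAddCommGroup E] [NormedSpace ℝ E] (A : E →L[ℝ] E)

/-- The closed form `cos s · 1 + sin s · A`. [folklore] -/
def cosSinCLM (s : ℝ) : E →L[ℝ] E := Real.cos s • 1 + Real.sin s • A

/-- Unfolding lemma for `cosSinCLM`. [folklore] -/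
theorem cosSinCLM_def (s : ℝ) : cosSinCLM A s = Real.cos s • 1 + Real.sin s • A := rfl

/-- `cosSinCLM A s x = cos s • x + sin s • A x`. [folklore] -/
theorem cosSinCLM_apply (s : ℝ) (x : E) : cosSinCLM A s x = Real.cos s • x + Real.sin s • A x := by
  simp [cosSinCLM]

/-- `cosSinCLM A 0 = 1`. [folklore] -/
theorem cosSinCLM_zero : cosSinCLM A 0 = 1 := by
  simp [cosSinCLM]

variable (hA : A * A = -1)
include hA

/-- The group law from the addition formulas and `A² = -1`. [folklore] -/
theorem cosSinCLM_add (s t : ℝ) : cosSinCLM A (s + t) = cosSinCLM A s * cosSinCLM A t := by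
  simp only [cosSinCLM, Real.cos_add, Real.sin_add, mul_add, add_mul, smul_mul_smul_comm, mul_one,
    one_mul, hA, add_smul, sub_eq_add_neg, smul_neg, neg_smul]
  abel

/-- `d/ds (cos s · 1 - sin s · A) = -A · (cos s · 1 - sin s · A)`, i.e. the derivative of
`s ↦ cosSinCLM A (-s)`. [folklore] -/
theorem hasDerivAt_cosSinCLM_neg (s₀ : ℝ) :
    HasDerivAt (fun s => cosSinCLM A (-s)) (-(A * cosSinCLM A (-s₀))) s₀ := by
  have h := ((Real.hasDerivAt_cos s₀).smul_const (1 : E →L[ℝ] E)).sub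
    ((Real.hasDerivAt_sin s₀).smul_const A)
  have e : -Real.sin s₀ • (1 : E →L[ℝ] E) - Real.cos s₀ • A = -(A * cosSinCLM A (-s₀)) := by
    simp only [cosSinCLM, Real.cos_neg, Real.sin_neg, mul_add, mul_smul_comm, mul_one, hA, neg_smul,
      mul_neg, neg_add, neg_neg, smul_neg]
    abel
  rw [← e]
  refine h.congr_of_eventuallyEq (Eventually.of_forall fun s => ?_)
  show cosSinCLM A (-s) = Real.cos s • (1 : E →L[ℝ] E) - Real.sin s • A
  rw [cosSinCLM, Real.cos_neg, Real.sin_neg, neg_smul, sub_eq_add_neg]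

variable [CompleteSpace E]

/-- The conserved quantity: `exp(sA) · (cos s · 1 - sin s · A) = 1` for all `s`. [folklore] -/
theorem expCLM_mul_cosSinCLM_neg (s : ℝ) : expCLM A s * cosSinCLM A (-s) = 1 := by
  have hd : ∀ t : ℝ, HasDerivAt (fun t => expCLM A t * cosSinCLM A (-t)) 0 t := by
    intro t
    have h1 : HasDerivAt (fun t : ℝ => expCLM A t) (A * NormedSpace.exp (t • A)) t :=
      hasDerivAt_exp_smul_const' A t
    have h := h1.mul (hasDerivAt_cosSinCLM_neg A hA t)
    have hc : A * NormedSpace.exp (t • A) = NormedSpace.exp (t • A) * A :=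
      (((Commute.refl A).smul_right t).exp_right).eq
    have e : A * NormedSpace.exp (t • A) * cosSinCLM A (-t)
        + expCLM A t * -(A * cosSinCLM A (-t)) = 0 := by
      rw [hc, expCLM_def, mul_neg, mul_assoc, add_neg_cancel]
    rw [← e]
    exact h
  have hconst := is_const_of_deriv_eq_zero (fun t => (hd t).differentiableAt) (fun t => (hd t).deriv)
  rw [hconst s 0, expCLM_zero, neg_zero, cosSinCLM_zero, one_mul]

/-- **`exp(sA) = cos s · 1 + sin s · A`** for `A² = -1`. [folklore] -/
theorem expCLM_eq_cosSinCLM (s : ℝ) : expCLM A s = cosSinCLM A s := by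
  calc expCLM A s = expCLM A s * (cosSinCLM A (-s) * cosSinCLM A s) := by
        rw [← cosSinCLM_add A hA, neg_add_cancel, cosSinCLM_zero, mul_one]
    _ = cosSinCLM A s := by rw [← mul_assoc, expCLM_mul_cosSinCLM_neg A hA, one_mul]

/-- `exp(sA) = cos s • 1 + sin s • A` (`A² = -1`), Mathlib-exponential form. [folklore] -/
theorem exp_smul_eq_cos_add_sin (s : ℝ) :
    NormedSpace.exp (s • A) = Real.cos s • (1 : E →L[ℝ] E) + Real.sin s • A :=
  expCLM_eq_cosSinCLM A hA s

/-- `expFlow A s = cosSinCLM A s` as a continuous linear map (`A² = -1`). [folklore] -/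
theorem coe_expFlow_eq_cosSinCLM (s : ℝ) :
    ((expFlow A s : E ≃L[ℝ] E) : E →L[ℝ] E) = cosSinCLM A s := by
  rw [coe_expFlow, exp_smul_eq_cos_add_sin A hA, cosSinCLM_def]

/-- `expFlow A s x = cos s • x + sin s • A x` (`A² = -1`). [folklore] -/
theorem expFlow_apply_eq_cos_add_sin (s : ℝ) (x : E) :
    expFlow A s x = Real.cos s • x + Real.sin s • A x := by
  rw [expFlow_apply, exp_smul_eq_cos_add_sin A hA]
  simp

/-- Periodicity `exp((s + 2π)A) = exp(sA)`: the subgroup is compact. [folklore] -/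
theorem expFlow_add_two_pi (s : ℝ) : expFlow A (s + 2 * Real.pi) = expFlow A s := by
  refine ContinuousLinearEquiv.ext (funext fun x => ?_)
  rw [expFlow_apply_eq_cos_add_sin A hA, expFlow_apply_eq_cos_add_sin A hA, Real.cos_add_two_pi,
    Real.sin_add_two_pi]

end ExpRotation

end Literature.Analysis.Distribution
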